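import Summits.SmoothPoincare4.SmoothPoincare4.Theses.SullivanDual

/-!
# SmoothPoincare4 / SullivanDual — assembly

Settles item stmt-SmoothPoincare4-11128 (assembly of route SullivanDual, rev 2):
`Target → RelativeSullivanDuality → ClosedModelExtension → GromovChartForm →
SympcapGlueChartStandardEnd → Spc4ReductionHomotopySphere → SmoothPoincare4`.

Pure logic.  The route file's own deciding theorem `SullivanDual.closes` takes exactly these six
hypotheses (in the order `Target`, `ClosedModelExtension`, `RelativeSullivanDuality`,
`GromovChartForm`, `SympcapGlueChartStandardEnd`, `Spc4ReductionHomotopySphere`) and concludes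
`SmoothPoincare4`; the assembly is that theorem with the second and third hypotheses swapped.
Nothing else is used (no named facts).
-/

-- the registered namespace `Summit.SmoothPoincare4.SmoothPoincare4.Theorems` repeats a component
set_option linter.dupNamespace false

namespace Summit.SmoothPoincare4.SmoothPoincare4.Theorems

open Summit.SmoothPoincare4.SmoothPoincare4.Theses.SullivanDual

/-- Settles stmt-SmoothPoincare4-11128: the assembly
`Target → RelativeSullivanDuality → ClosedModelExtension → GromovChartForm →
SympcapGlueChartStandardEnd → Spc4ReductionHomotopySphere → SmoothPoincare4` of route SullivanDual.
Proof: unfold `Assembly` and apply the route's deciding theorem `SullivanDual.closes` (pick `p ∈ Σ`;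
`Target` gives `J`, `ε₁`; `ClosedModelExtension` gives `ε₀` and a closed model form, restricted to
`ε = min ε₀ ε₁`; `RelativeSullivanDuality` gives a symplectic form standard near `p`;
`GromovChartForm` gives `Φ : Σ∖p ≃ₘ ℝ⁴` standard near `p`; `SympcapGlueChartStandardEnd` closes it
to `Σ ≅ S⁴`; `Spc4ReductionHomotopySphere` packages `SmoothPoincare4`). [folklore] -/
theorem SullivanDual_Assembly_proof :
    Summit.SmoothPoincare4.SmoothPoincare4.Theses.SullivanDual.Assembly := by
  unfold Assembly
  intro hT hRSD hCME hG hGlue hRed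
  exact closes hT hCME hRSD hG hGlue hRed

end Summit.SmoothPoincare4.SmoothPoincare4.Theorems
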